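import Summits.HubbardSuperconductivity.HubbardSuperconductivity.Theses.NodalWardXY
import Literature.MathematicalPhysics.QuantumLattice.DWaveOrderParameterProofs

/-!
# Vocabulary of the line `Sketch` (zero-field Koma–Tasaki bridge) for the crux
# `NodalWardXY.NodalReduction` (stmt-HubbardSuperconductivity-1268)

Route-posited statements (D-0016: `Theorems/<RouteSlug><Crux>Defs.lean`, reviewed), VERBATIM the
statement block of the checked skeleton `Cruxes/NodalReduction/Lines/Sketch.lean`, so that the stubs of the
line, which land as separate `Theorems` files, share one set of named `Prop`s and each lands as
`theorem stub_<name> : <registered signature>` importing this file (the gate's `supports.stub-mismatch`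
rule matches name + signature text). Same idiom as `Theorems/NodalWardXYDefs.lean` (sibling crux
`PerturbedXYOrder`) and `CardySusyWardParafermionFamiliesToSLESixDefs.lean`.

The line realises the crux as `KTBridge → ZeroFieldTarget → NodalReduction` (`nodalReduction_of_zeroField`,
pure logic, PROVED here), where

* `ZeroFieldTarget` is the re-aimed conclusion (zero-field torus PLATEAU pair order of the tracial
  grand-canonical ground state at a density-matched `μ`, in a weak-coupling window) — the physics;
* `KTBridge` is the Koma–Tasaki / Kaplan–Horsch–von der Linden direction "plateau LRO ⇒ sourced order
  parameter" for the grand-canonical Hubbard torus (T. Koma, H. Tasaki, CMP 158 (1993) 191, Thm 7.1/7.3;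
  J. Stat. Phys. 76 (1994) 745, Thm 2.2), assembled (`stub_ktBridge_of` of the skeleton) from the five
  statements `TrialStateBound` (A), `DoubleCommutatorForm` (B), `OrderSqLower` (C), `SelectionRules` (D),
  `GoodGroundVector` (E).

Objects: `hubbardTorusWith 2 L 1 U μ = H(1,U) − μN` on the Fock space of `(ℤ/Lℤ)²`, the `d_{x²-y²}` pair
field `Δ = pairField dWaveFormFactor L`, the order operator `O = Δ + Δᴴ`, the tracial ground-state functional
`Matrix.groundStateFunctional`, `Matrix.groundEnergy`, `dWaveOrderParameter` (all tree notions; the matrix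
norm is the `L²` operator norm). Nothing beyond the eight-line composition is asserted here.
-/

noncomputable section

-- `Summit.HubbardSuperconductivity.HubbardSuperconductivity.…` is the tree's summit/sub-problem namespace (D-0017).
set_option linter.dupNamespace false

namespace Summit.HubbardSuperconductivity.HubbardSuperconductivity.Theorems.NodalReduction

open Filter Matrix
open Literature.MathematicalPhysics.QuantumLattice Literature.Probability.LatticeModels
open Summit.HubbardSuperconductivity.HubbardSuperconductivity.Theses.NodalWardXY
open scoped Matrix.Norms.L2Operator ComplexOrder Topology

/-- (A) Abstract Kaplan–Horsch–von der Linden / Koma–Tasaki trial-state inequality (finite-dimensional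
linear algebra). For Hermitian `K, O`, a unit ground vector `Φ` of `K` with `⟨Φ,OΦ⟩ = 0 = ⟨Φ,O³Φ⟩` and
`OΦ ≠ 0`, the unit trial state `Ξ = (Φ + OΦ/‖OΦ‖)/√2` has `⟨Ξ,OΞ⟩ = ‖OΦ‖` and
`⟨Ξ,KΞ⟩ = E₀ + ⟨Φ,[[O,K],O]Φ⟩/(4‖OΦ‖²)`, whence for `h ≥ 0`:
`E₀(K − hO) ≤ E₀(K) + Re⟨Φ,[[O,K],O]Φ⟩/(4‖OΦ‖²) − h‖OΦ‖` (Koma–Tasaki 1994, proof of Thm 2.2;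
Kaplan–Horsch–von der Linden 1989). Norms of vectors are written as `Re (star v ⬝ᵥ v)`. -/
def TrialStateBound : Prop :=
  ∀ {n : Type} [Fintype n] [DecidableEq n] (K O : Matrix n n ℂ), K.IsHermitian → O.IsHermitian →
    ∀ (Φ : n → ℂ), star Φ ⬝ᵥ Φ = 1 → K *ᵥ Φ = (K.groundEnergy : ℂ) • Φ →
    star Φ ⬝ᵥ (O *ᵥ Φ) = 0 → star Φ ⬝ᵥ ((O * O * O) *ᵥ Φ) = 0 →
    0 < (star (O *ᵥ Φ) ⬝ᵥ (O *ᵥ Φ)).re →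
    ∀ h : ℝ, 0 ≤ h →
      (K - (h : ℂ) • O).groundEnergy ≤
        K.groundEnergy
          + (star Φ ⬝ᵥ ((((O * K - K * O) * O - O * (O * K - K * O))) *ᵥ Φ)).re
              / (4 * (star (O *ᵥ Φ) ⬝ᵥ (O *ᵥ Φ)).re)
          - h * Real.sqrt ((star (O *ᵥ Φ) ⬝ᵥ (O *ᵥ Φ)).re)

/-- (B) Double-commutator form bound for the `d`-wave order operator on the Hubbard torus:
`Re⟨Φ, [[O,H],O] Φ⟩ ≤ C₂ L²` for unit `Φ`, `O = Δ + Δᴴ`, `H = hubbardTorusWith 2 L 1 U μ`, with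
`C₂ = C₂(U,μ)` independent of `L` (graded locality of the CAR algebra and the volume-independent
commutator bound `‖[H, c_{xσ}]‖ = O(1)`; Koma–Tasaki 1994, (2.9)). -/
def DoubleCommutatorForm : Prop :=
  ∀ U μ : ℝ, ∃ C₂ : ℝ, ∀ (L : ℕ) [NeZero L] (Φ : Finset (Orb (FermionTorus 2 L)) → ℂ),
    star Φ ⬝ᵥ Φ = 1 →
    let O := pairField dWaveFormFactor L + (pairField dWaveFormFactor L)ᴴ
    let H := hubbardTorusWith 2 L 1 U μ
    (star Φ ⬝ᵥ ((((O * H - H * O) * O - O * (O * H - H * O))) *ᵥ Φ)).re ≤ C₂ * (L : ℝ) ^ 2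

/-- (C) Lower bound on `‖OΦ‖²` by the pair long-range order: for unit `Φ` with `⟨Φ,Δ²Φ⟩ = 0 = ⟨Φ,Δᴴ²Φ⟩`,
`2 Re⟨Φ,ΔᴴΔΦ⟩ − C₁L² ≤ ‖OΦ‖²` (`O² = Δ² + Δᴴ² + ΔᴴΔ + ΔΔᴴ`, `ΔΔᴴ = ΔᴴΔ + [Δ,Δᴴ]`, and
`‖[Δ,Δᴴ]‖ ≤ C₁L²` since local pairs at sites without a common orbital commute). -/
def OrderSqLower : Prop :=
  ∃ C₁ : ℝ, ∀ (L : ℕ) [NeZero L] (Φ : Finset (Orb (FermionTorus 2 L)) → ℂ),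
    star Φ ⬝ᵥ Φ = 1 →
    star Φ ⬝ᵥ ((pairField dWaveFormFactor L * pairField dWaveFormFactor L) *ᵥ Φ) = 0 →
    star Φ ⬝ᵥ (((pairField dWaveFormFactor L)ᴴ * (pairField dWaveFormFactor L)ᴴ) *ᵥ Φ) = 0 →
    let O := pairField dWaveFormFactor L + (pairField dWaveFormFactor L)ᴴ
    2 * (star Φ ⬝ᵥ (((pairField dWaveFormFactor L)ᴴ * pairField dWaveFormFactor L) *ᵥ Φ)).re
        - C₁ * (L : ℝ) ^ 2
      ≤ (star (O *ᵥ Φ) ⬝ᵥ (O *ᵥ Φ)).re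

/-- (D) `U(1)` selection rules: in an eigenvector of the total particle number `N` every operator of
non-zero charge has vanishing expectation — here `O = Δ + Δᴴ` (charges `∓2`), `Δ²`, `Δᴴ²` (charges `∓4`)
and `O³` (charges in `{±2, ±6}`) (Koma–Tasaki 1994, (2.18)). -/
def SelectionRules : Prop :=
  ∀ (L : ℕ) [NeZero L] (Φ : Finset (Orb (FermionTorus 2 L)) → ℂ) (c : ℂ),
    totalNumber *ᵥ Φ = c • Φ →
    let Δ := pairField dWaveFormFactor L
    let O := Δ + Δᴴ
    star Φ ⬝ᵥ (O *ᵥ Φ) = 0 ∧ star Φ ⬝ᵥ ((Δ * Δ) *ᵥ Φ) = 0 ∧ star Φ ⬝ᵥ ((Δᴴ * Δᴴ) *ᵥ Φ) = 0 ∧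
      star Φ ⬝ᵥ ((O * O * O) *ᵥ Φ) = 0

/-- (E) A good ground vector (finite-dimensional linear algebra): for commuting Hermitian `K, N` and
positive semidefinite `A`, the tracial ground-state functional of `K` is the average of `⟨Φᵢ,AΦᵢ⟩` over an
`N`-adapted orthonormal basis `(Φᵢ)` of the ground space of `K`, so some joint eigenvector (`KΦ = E₀Φ`,
`NΦ = cΦ`, `‖Φ‖ = 1`) has `Re⟨Φ,AΦ⟩ ≥ Re ω_K(A)`. -/
def GoodGroundVector : Prop :=
  ∀ {n : Type} [Fintype n] [DecidableEq n] [Nonempty n] (K N A : Matrix n n ℂ),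
    K.IsHermitian → N.IsHermitian → K * N = N * K → A.PosSemidef →
    ∀ t : ℝ, t ≤ (K.groundStateFunctional A).re →
      ∃ (Φ : n → ℂ) (c : ℂ), star Φ ⬝ᵥ Φ = 1 ∧ K *ᵥ Φ = (K.groundEnergy : ℂ) • Φ ∧ N *ᵥ Φ = c • Φ ∧
        t ≤ (star Φ ⬝ᵥ (A *ᵥ Φ)).re

/-- The Koma–Tasaki / Kaplan–Horsch–von der Linden bridge for the grand-canonical Hubbard torus: a plateau
`a > 0` of `d_{x²-y²}` pair long-range order in the tracial ground state at ZERO field,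
`a (L+1)⁴ ≤ Re ω₀^{L+1}(ΔᴴΔ)` eventually, forces `√(a/2) ≤ dWaveOrderParameter U μ` (Koma–Tasaki, CMP 158
(1993), Thm 7.1/7.3 transposed to the pair operator; the factor `1/2` is the tree's normalisation
`dWaveSourceDensity = Re ω(Δ)/L² = ½ Re ω(O)/L²`). -/
def KTBridge : Prop :=
  ∀ U μ a : ℝ, 0 < a →
    (∀ᶠ L : ℕ in atTop, a * (((L + 1 : ℕ) : ℝ)) ^ 4 ≤
      ((hubbardTorusWith 2 (L + 1) 1 U μ).groundStateFunctional
        ((pairField dWaveFormFactor (L + 1))ᴴ * pairField dWaveFormFactor (L + 1))).re) →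
    Real.sqrt (a / 2) ≤ dWaveOrderParameter U μ

/-- (Z) The re-aimed conclusion of the crux (the PHYSICS of `NodalReduction`): from the two engines
`VisonPairCost`, `PerturbedXYOrder`, a doping `δ ∈ (0,1/2)` and a weak-coupling window `U ∈ (0,U₀)` with a
density-matched `μ` at which the tracial grand-canonical ground state of `hubbardTorusWith 2 (L+1) 1 U μ`
has a zero-field PLATEAU `a·(L+1)⁴ ≤ Re ω₀(ΔᴴΔ)` eventually in `L` (the output format of the XY engine). -/
def ZeroFieldTarget : Prop :=
  VisonPairCost → PerturbedXYOrder →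
    ∃ δ ∈ Set.Ioo (0:ℝ) (1/2), ∃ U₀ : ℝ, 0 < U₀ ∧ ∀ U ∈ Set.Ioo (0:ℝ) U₀, ∃ μ : ℝ,
      Filter.Tendsto (fun L : ℕ => ((hubbardTorusWith 2 (L + 1) 1 U μ).groundStateFunctional
        totalNumber).re / ((L + 1 : ℕ) : ℝ) ^ 2) Filter.atTop (nhds (1 - δ)) ∧
      ∃ a : ℝ, 0 < a ∧ ∀ᶠ L : ℕ in atTop, a * (((L + 1 : ℕ) : ℝ)) ^ 4 ≤
        ((hubbardTorusWith 2 (L + 1) 1 U μ).groundStateFunctional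
          ((pairField dWaveFormFactor (L + 1))ᴴ * pairField dWaveFormFactor (L + 1))).re

/-- **Composition (pure logic).** The bridge turns the re-aimed target into the crux `NodalReduction` BY
NAME: `ZeroFieldTarget` supplies `δ, U₀` and, for each `U`, a density-matched `μ` with a plateau `a > 0`;
`KTBridge` gives `dWaveOrderParameter U μ ≥ √(a/2) > 0`, i.e. `HasDWaveOrder U μ`. -/
theorem nodalReduction_of_zeroField : KTBridge → ZeroFieldTarget → NodalReduction := by
  intro hB hT hV hE
  obtain ⟨δ, hδ, U₀, hU₀, hwin⟩ := hT hV hE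
  refine ⟨δ, hδ, U₀, hU₀, fun U hU => ?_⟩
  obtain ⟨μ, hdens, a, ha, hplat⟩ := hwin U hU
  refine ⟨μ, hdens, ?_⟩
  have h : Real.sqrt (a / 2) ≤ dWaveOrderParameter U μ := hB U μ a ha hplat
  have hs : (0 : ℝ) < Real.sqrt (a / 2) := Real.sqrt_pos.2 (by linarith)
  show (0 : ℝ) < dWaveOrderParameter U μ
  exact lt_of_lt_of_le hs h

end Summit.HubbardSuperconductivity.HubbardSuperconductivity.Theorems.NodalReduction

end
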